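import Summits.Ventures.PackingBounds.Energy.FivePointRieszSixGramDataE1
import Summits.Ventures.PackingBounds.Energy.FivePointRieszSixGramDataE2
import Summits.Ventures.PackingBounds.Energy.FivePointRieszSixGramDataE3
import Summits.Ventures.PackingBounds.Energy.FivePointRieszSixGramDataE4
import HarnessLib

/-!
# Integer Gram data `S·Y = L Lᵀ + E` (the rows of E: the table (collector of 4 part modules)) of the 158 × 158 SOS block of the exact sharp three-point certificate
# `e3pt-sharp-n3N5s6d8-none.json` (triangular bipyramid; five points on S², single SOS term, d = 8)

Framing: lottery ticket; floor = certified bounds/negative ranges. Venture `PackingBounds`, cell `pub-packcert`, energy family E3PT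
(pub-packcert-energy gen 15; KERNEL-D6 data route). `yR6` = S·Y (S = `scaleR6` = lcm of denominators · 2^40), `lR6` = rounded scaled Cholesky
factor, `eR6` = S·Y − lR6·lR6ᵀ (exact; symmetric, diagonally dominant). Checked by `decide +kernel` with `GramData.checkRows` / `checkDD`
in `FivePointRieszSixGramFacts*`; generator `pub-packcert-energy/code/e3pt/g15/e3pt_lean_n3x.py`. (Rows split in independent modules for the gate's request-size limit; one collector per table.)
-/

namespace Summit.Ventures.PackingBounds.Energy.RieszSixD8

/-- data rows. -/
def eR6 : List (List ℤ) := [eR60, eR61, eR62, eR63, eR64, eR65, eR66, eR67, eR68, eR69, eR610, eR611, eR612, eR613, eR614, eR615, eR616, eR617, eR618, eR619, eR620, eR621, eR622, eR623, eR624, eR625, eR626, eR627, eR628, eR629, eR630, eR631, eR632, eR633, eR634, eR635, eR636, eR637, eR638, eR639, eR640, eR641, eR642, eR643, eR644, eR645, eR646, eR647, eR648, eR649, eR650, eR651, eR652, eR653, eR654, eR655, eR656, eR657, eR658, eR659, eR660, eR661, eR662, eR663, eR664, eR665, eR666, eR667, eR668, eR669, eR670, eR671, eR672, eR673, eR674,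 eR675, eR676, eR677, eR678, eR679, eR680, eR681, eR682, eR683, eR684, eR685, eR686, eR687, eR688, eR689, eR690, eR691, eR692, eR693, eR694, eR695, eR696, eR697, eR698, eR699, eR6100, eR6101, eR6102, eR6103, eR6104, eR6105, eR6106, eR6107, eR6108, eR6109, eR6110, eR6111, eR6112, eR6113, eR6114, eR6115, eR6116, eR6117, eR6118, eR6119, eR6120, eR6121, eR6122, eR6123, eR6124, eR6125, eR6126, eR6127, eR6128, eR6129, eR6130, eR6131, eR6132, eR6133, eR6134, eR6135, eR6136, eR6137, eR6138, eR6139, eR6140, eR6141, eR6142, eR6143, eR6144, eR6145, eR6146, eR6147, eR6148, eR6149, eR6150, eR6151, eR6152, eR6153, eR6154, eR6155, eR6156, eR6157]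

end Summit.Ventures.PackingBounds.Energy.RieszSixD8
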